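import Summits.Parity.GeneralizedHardyLittlewood.Theorems.LiouvilleShiftedTablesTypeI2DilatedURB1
import Literature.NumberTheory.Sieve.DirichletTupleExpansion
import Literature.NumberTheory.Sieve.BombieriFriedlanderIwaniecBoxes

/-!
# The `𝔲_R` terms of the assembly (`stub_uRBound`), file 4: two-factor expansion of `NS(α ⋆ β)` (Type II bookkeeping)

Route `LiouvilleShiftedTables` (Parity / GeneralizedHardyLittlewood), crux `TypeI2Dilated` (stmt-Parity-14272), line
`peel-to-drappeau`, registered stub `stub_uRBound : URBound`; continuation of `…URB1` (imports only `…URB1`).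

For a TYPE II box piece `F_{j,κ} = α ⋆ β` (`α`, `β` the products of the slots outside / inside a set `S` of slots)
the hypothesis `DilatedTypeII` is stated for dyadic ranges `m ∼ M`, `n ∼ N` and the window-and-classes condition written
out.  This file performs the purely combinatorial passage from `NS(α ⋆ β)` to such sums:

* `exists_mem_dyadic_two_pow`, `pairwiseDisjoint_dyadic_two_pow` — `(A, 2^a A]` is the disjoint union of the `a`
  dyadic ranges `(2^i A, 2^{i+1} A]`;
* `mem_classFilter_iff'` — the class filter as the window `0 < k ≤ Y` plus the two classes;
* `conv_classFilter_expand` — `∑_{m ∈ CF} (α ⋆ β)(m) u(m) = ∑_{i<a} ∑_{i'<b} ∑_{m ∼ 2^iA} ∑_{n ∼ 2^{i'}B} [mn ∈ CF] α(m)β(n)u(mn)`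
  (`TupleSums.sum_prod_apply_mul_eq_sum_piFinset` with two factors);
* `normSum_conv_le` — `NS(α ⋆ β) ≤ ∑_{i<a} ∑_{i'<b} ∑_{q,r} ‖∑_s ∑_{m ∼ M_i} ∑_{n ∼ N_{i'}} [mn ∈ CF] α β 𝔲‖`;
* `sum_le_sum_dilate` — re-indexing `r ↦ rP` (`∑_{r ≤ R} g(rP) ≤ ∑_{r' ≤ RP} g(r')` for `g ≥ 0`).
[this line: Lines/peel-to-drappeau.md; cite: Drappeau2017, §6]
-/

noncomputable section

namespace Summit.Parity.GeneralizedHardyLittlewood.Cruxes.TypeI2Dilated.PeelToDrappeau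

open Finset Fintype Real Filter
open scoped ArithmeticFunction.sigma Classical
open Literature.NumberTheory.Sieve Literature.NumberTheory.Sieve.Drappeau2017

/-! ### Dyadic pieces of `(A, 2^a A]` -/

/-- Every `m` with `A < m ≤ 2^a A` lies in one of the dyadic ranges `(2^i A, 2^{i+1} A]`, `i < a`. [folklore] -/
theorem exists_mem_dyadic_two_pow {A : ℝ} (hA : 0 < A) {a : ℕ} {m : ℕ} (h1 : A < m) (h2 : (m : ℝ) ≤ 2 ^ a * A) :
    ∃ i ∈ Finset.range a, m ∈ BFI.dyadic (2 ^ i * A) := by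
  induction a with
  | zero =>
      rw [pow_zero, one_mul] at h2
      linarith
  | succ a ih =>
      by_cases hm : (m : ℝ) ≤ 2 ^ a * A
      · obtain ⟨i, hi, hmem⟩ := ih hm
        exact ⟨i, Finset.mem_range.2 ((Finset.mem_range.1 hi).trans (Nat.lt_succ_self a)), hmem⟩
      · push Not at hm
        refine ⟨a, Finset.mem_range.2 (Nat.lt_succ_self a), ?_⟩
        rw [BFI.mem_dyadic (by positivity)]
        refine ⟨hm, ?_⟩
        rw [pow_succ] at h2
        linarith

/-- The dyadic ranges `(2^i A, 2^{i+1} A]` are pairwise disjoint (`A > 0`). [folklore] -/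
theorem pairwiseDisjoint_dyadic_two_pow {A : ℝ} (hA : 0 < A) (a : ℕ) :
    ((Finset.range a : Set ℕ)).PairwiseDisjoint (fun i => BFI.dyadic (2 ^ i * A)) := by
  intro i _ i' _ hne
  rw [Function.onFun, Finset.disjoint_left]
  intro m hm hm'
  rw [BFI.mem_dyadic (by positivity)] at hm hm'
  rcases lt_or_gt_of_ne hne with h | h
  · have h2 : (2 : ℝ) ^ (i + 1) ≤ 2 ^ i' := pow_le_pow_right₀ (by norm_num) h
    have : (m : ℝ) ≤ 2 ^ i' * A := by rw [pow_succ] at h2; nlinarith [hm.2]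
    linarith [hm'.1]
  · have h2 : (2 : ℝ) ^ (i' + 1) ≤ 2 ^ i := pow_le_pow_right₀ (by norm_num) h
    have : (m : ℝ) ≤ 2 ^ i * A := by rw [pow_succ] at h2; nlinarith [hm'.2]
    linarith [hm.1]

/-! ### The class filter as a window plus classes -/

/-- `k ∈ classFilter c q w r Y ↔ 0 < k ≤ Y ∧ k ≡ c (r) ∧ k ≡ w + c (q)`. [this line] -/
theorem mem_classFilter_iff' (c : ℤ) (q w r : ℕ) (Y : ℝ) (k : ℕ) :
    k ∈ classFilter c q w r Y ↔ (0 < (k : ℝ) ∧ (k : ℝ) ≤ Y ∧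
      (k : ZMod r) = ((c : ℤ) : ZMod r) ∧ (k : ZMod q) = (((w : ℤ) + c : ℤ) : ZMod q)) := by
  unfold classFilter
  rw [Finset.mem_filter, Finset.mem_Icc]
  have hwin : (1 ≤ k ∧ k ≤ ⌊Y⌋₊) ↔ (0 < (k : ℝ) ∧ (k : ℝ) ≤ Y) := by
    rcases le_or_gt 0 Y with hY | hY
    · rw [Nat.le_floor_iff hY]
      constructor
      · rintro ⟨h1, h2⟩; exact ⟨by exact_mod_cast h1, h2⟩
      · rintro ⟨h1, h2⟩; exact ⟨by exact_mod_cast h1, h2⟩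
    · rw [Nat.floor_of_nonpos hY.le]
      constructor
      · rintro ⟨h1, h2⟩; omega
      · rintro ⟨-, h2⟩
        have : (0 : ℝ) ≤ k := Nat.cast_nonneg k
        linarith
  rw [hwin, and_assoc]

/-- `0 ∉ classFilter`. [this line] -/
theorem zero_notMem_classFilter (c : ℤ) (q w r : ℕ) (Y : ℝ) : (0 : ℕ) ∉ classFilter c q w r Y := by
  intro h
  have := classFilter_subset c q w r Y h
  simp at this

/-! ### Two-factor expansion -/

/-- **Two-factor expansion over dyadic pieces**: if `α` is supported in `(A, 2^a A]` and `β` in `(B, 2^b B]`, then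
`∑_{m ∈ CF} (α ⋆ β)(m) u(m) = ∑_{i<a} ∑_{i'<b} ∑_{m ∼ 2^iA} ∑_{n ∼ 2^{i'}B} [mn ∈ CF] α(m) β(n) u(mn)`. [this line] -/
theorem conv_classFilter_expand (α β : ArithmeticFunction ℝ) {A B : ℝ} (hA : 0 < A) (hB : 0 < B) (a b : ℕ)
    (hα : ∀ m, α m ≠ 0 → A < m ∧ (m : ℝ) ≤ 2 ^ a * A) (hβ : ∀ n, β n ≠ 0 → B < n ∧ (n : ℝ) ≤ 2 ^ b * B)
    (c : ℤ) (q w r : ℕ) (Y : ℝ) (u : ℕ → ℂ) :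
    ∑ m ∈ classFilter c q w r Y, (((α * β) m : ℝ) : ℂ) * u m =
      ∑ i ∈ Finset.range a, ∑ i' ∈ Finset.range b, ∑ m ∈ BFI.dyadic (2 ^ i * A), ∑ n ∈ BFI.dyadic (2 ^ i' * B),
        if m * n ∈ classFilter c q w r Y then ((α m : ℝ) : ℂ) * ((β n : ℝ) : ℂ) * u (m * n) else 0 := by
  set Dα : Finset ℕ := (Finset.range a).biUnion (fun i => BFI.dyadic (2 ^ i * A)) with hDα
  set Dβ : Finset ℕ := (Finset.range b).biUnion (fun i => BFI.dyadic (2 ^ i * B)) with hDβ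
  set f : Fin 2 → ArithmeticFunction ℝ := ![α, β] with hf
  set D : Fin 2 → Finset ℕ := ![Dα, Dβ] with hDdef
  have hD : ∀ i m, f i m ≠ 0 → m ∈ D i := by
    intro i m hm
    fin_cases i
    · obtain ⟨h1, h2⟩ := hα m hm
      obtain ⟨i, hi, hmem⟩ := exists_mem_dyadic_two_pow hA h1 h2
      exact Finset.mem_biUnion.2 ⟨i, hi, hmem⟩
    · obtain ⟨h1, h2⟩ := hβ m hm
      obtain ⟨i, hi, hmem⟩ := exists_mem_dyadic_two_pow hB h1 h2
      exact Finset.mem_biUnion.2 ⟨i, hi, hmem⟩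
  have key := TupleSums.sum_prod_apply_mul_eq_sum_piFinset 2 f D hD (classFilter c q w r Y)
    (zero_notMem_classFilter c q w r Y) u
  have hfprod : (∏ i, f i) = α * β := by rw [Fin.prod_univ_two]; rfl
  rw [hfprod] at key
  rw [key]
  -- tuples over `Fin 2` are pairs
  have h2 : ∑ t ∈ piFinset D, (if (∏ i, t i) ∈ classFilter c q w r Y then
        (∏ i, (f i (t i) : ℂ)) * u (∏ i, t i) else 0) =
      ∑ m ∈ Dα, ∑ n ∈ Dβ,
        (if m * n ∈ classFilter c q w r Y then ((α m : ℝ) : ℂ) * ((β n : ℝ) : ℂ) * u (m * n) else 0) := by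
    rw [← Finset.sum_product' (s := Dα) (t := Dβ) (f := fun m n =>
      if m * n ∈ classFilter c q w r Y then ((α m : ℝ) : ℂ) * ((β n : ℝ) : ℂ) * u (m * n) else 0)]
    refine Finset.sum_equiv (finTwoArrowEquiv ℕ) (fun t => ?_) (fun t _ => ?_)
    · simp only [Fintype.mem_piFinset, Fin.forall_fin_two, Finset.mem_product]
      rfl
    · simp [Fin.prod_univ_two, hf]
  rw [h2, Finset.sum_biUnion (pairwiseDisjoint_dyadic_two_pow hA a)]
  refine Finset.sum_congr rfl fun i _ => ?_
  rw [Finset.sum_congr rfl fun m _ => Finset.sum_biUnion (pairwiseDisjoint_dyadic_two_pow hB b), Finset.sum_comm]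

/-! ### `NS(α ⋆ β)` -/

/-- **`NS(α ⋆ β)` against dyadic pieces**: with `α`, `β` supported in `(A, 2^a A]`, `(B, 2^b B]`,
`NS(α ⋆ β) ≤ ∑_{i<a} ∑_{i'<b} ∑_{q ≤ x^ρ} ∑_{r ≤ R} ‖∑_{s} ∑_{m ∼ 2^iA} ∑_{n ∼ 2^{i'}B} [mn ∈ CF] α(m) β(n) 𝔲_{Rd}(mn c̄; s)‖`.
[this line] -/
theorem normSum_conv_le (α β : ArithmeticFunction ℝ) {A B : ℝ} (hA : 0 < A) (hB : 0 < B) (a b : ℕ)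
    (hα : ∀ m, α m ≠ 0 → A < m ∧ (m : ℝ) ≤ 2 ^ a * A) (hβ : ∀ n, β n ≠ 0 → B < n ∧ (n : ℝ) ≤ 2 ^ b * B)
    (c : ℤ) (w P : ℕ) (x ρ Y R Slo : ℝ) :
    normSum c w P x ρ Y R Slo (fun m => (α * β) m) ≤
      ∑ i ∈ Finset.range a, ∑ i' ∈ Finset.range b, ∑ q ∈ Icc 1 ⌊x ^ ρ⌋₊, ∑ r ∈ Icc 1 ⌊R⌋₊,
        ‖∑ s ∈ sRange c q (r * P) Slo (2 * Slo), ∑ m ∈ BFI.dyadic (2 ^ i * A), ∑ n ∈ BFI.dyadic (2 ^ i' * B),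
          (if m * n ∈ classFilter c q w (r * P) Y then
            ((α m : ℝ) : ℂ) * ((β n : ℝ) : ℂ) * uR (x ^ (40 * ρ)) s (((m * n : ℕ) : ZMod s) * ((c : ZMod s))⁻¹)
            else 0)‖ := by
  -- the `(i, i')`-terms
  set G : ℕ → ℕ → ℕ → ℕ → ℝ := fun i i' q r =>
    ‖∑ s ∈ sRange c q (r * P) Slo (2 * Slo), ∑ m ∈ BFI.dyadic (2 ^ i * A), ∑ n ∈ BFI.dyadic (2 ^ i' * B),
      (if m * n ∈ classFilter c q w (r * P) Y then
        ((α m : ℝ) : ℂ) * ((β n : ℝ) : ℂ) * uR (x ^ (40 * ρ)) s (((m * n : ℕ) : ZMod s) * ((c : ZMod s))⁻¹)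
        else 0)‖ with hG
  -- one `(q, r)` term
  have hqr : ∀ q r : ℕ, ‖∑ s ∈ sRange c q (r * P) Slo (2 * Slo), ∑ m ∈ classFilter c q w (r * P) Y,
      (((α * β) m : ℝ) : ℂ) * uR (x ^ (40 * ρ)) s ((m : ZMod s) * ((c : ZMod s))⁻¹)‖ ≤
      ∑ i ∈ Finset.range a, ∑ i' ∈ Finset.range b, G i i' q r := by
    intro q r
    have hexp : ∀ s ∈ sRange c q (r * P) Slo (2 * Slo), ∑ m ∈ classFilter c q w (r * P) Y,
        (((α * β) m : ℝ) : ℂ) * uR (x ^ (40 * ρ)) s ((m : ZMod s) * ((c : ZMod s))⁻¹) =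
        ∑ i ∈ Finset.range a, ∑ i' ∈ Finset.range b, ∑ m ∈ BFI.dyadic (2 ^ i * A),
          ∑ n ∈ BFI.dyadic (2 ^ i' * B), (if m * n ∈ classFilter c q w (r * P) Y then
            ((α m : ℝ) : ℂ) * ((β n : ℝ) : ℂ) * uR (x ^ (40 * ρ)) s (((m * n : ℕ) : ZMod s) * ((c : ZMod s))⁻¹)
            else 0) :=
      fun s _ => conv_classFilter_expand α β hA hB a b hα hβ c q w (r * P) Y _
    rw [Finset.sum_congr rfl hexp, Finset.sum_comm]
    refine (norm_sum_le _ _).trans (Finset.sum_le_sum fun i _ => ?_)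
    rw [Finset.sum_comm]
    refine (norm_sum_le _ _).trans (Finset.sum_le_sum fun i' _ => le_of_eq ?_)
    simp only [hG]
  unfold normSum
  calc _ ≤ ∑ q ∈ Icc 1 ⌊x ^ ρ⌋₊, ∑ r ∈ Icc 1 ⌊R⌋₊, ∑ i ∈ Finset.range a, ∑ i' ∈ Finset.range b, G i i' q r :=
        Finset.sum_le_sum fun q _ => Finset.sum_le_sum fun r _ => hqr q r
    _ = ∑ q ∈ Icc 1 ⌊x ^ ρ⌋₊, ∑ i ∈ Finset.range a, ∑ i' ∈ Finset.range b, ∑ r ∈ Icc 1 ⌊R⌋₊, G i i' q r := by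
        refine Finset.sum_congr rfl fun q _ => ?_
        rw [Finset.sum_comm]
        exact Finset.sum_congr rfl fun i _ => Finset.sum_comm
    _ = ∑ i ∈ Finset.range a, ∑ q ∈ Icc 1 ⌊x ^ ρ⌋₊, ∑ i' ∈ Finset.range b, ∑ r ∈ Icc 1 ⌊R⌋₊, G i i' q r :=
        Finset.sum_comm
    _ = ∑ i ∈ Finset.range a, ∑ i' ∈ Finset.range b, ∑ q ∈ Icc 1 ⌊x ^ ρ⌋₊, ∑ r ∈ Icc 1 ⌊R⌋₊, G i i' q r :=
        Finset.sum_congr rfl fun i _ => Finset.sum_comm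
    _ = _ := by simp only [hG]

/-! ### Re-indexing `r ↦ rP` -/

/-- **Dilating the `r`-range**: for `g ≥ 0`, `P ≥ 1`, `R ≥ 0`: `∑_{r ≤ R} g(rP) ≤ ∑_{r' ≤ RP} g(r')`. [folklore] -/
theorem sum_le_sum_dilate {g : ℕ → ℝ} (hg : ∀ r, 0 ≤ g r) {P : ℕ} (hP : 1 ≤ P) {R : ℝ} (hR : 0 ≤ R) :
    ∑ r ∈ Icc 1 ⌊R⌋₊, g (r * P) ≤ ∑ r' ∈ Icc 1 ⌊R * P⌋₊, g r' := by
  have hinj : Set.InjOn (fun r : ℕ => r * P) (Icc 1 ⌊R⌋₊ : Finset ℕ) := fun r₁ _ r₂ _ h =>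
    Nat.eq_of_mul_eq_mul_right (by omega) h
  rw [← Finset.sum_image hinj]
  refine Finset.sum_le_sum_of_subset_of_nonneg (fun r' hr' => ?_) fun _ _ _ => hg _
  rw [Finset.mem_image] at hr'
  obtain ⟨r, hr, rfl⟩ := hr'
  rw [Finset.mem_Icc] at hr ⊢
  refine ⟨Nat.one_le_iff_ne_zero.2 (Nat.mul_ne_zero (by omega) (by omega)), Nat.le_floor ?_⟩
  push_cast
  exact mul_le_mul_of_nonneg_right ((Nat.cast_le.2 hr.2).trans (Nat.floor_le hR)) (Nat.cast_nonneg _)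

/-- Enlarging the `q`-range: `⌊x^ρ⌋ ≤ ⌊x^{ρ'}⌋` for `ρ ≤ ρ'`, `x ≥ 1`. [folklore] -/
theorem Icc_floor_rpow_subset {x ρ ρ' : ℝ} (hx : 1 ≤ x) (h : ρ ≤ ρ') : Icc 1 ⌊x ^ ρ⌋₊ ⊆ Icc 1 ⌊x ^ ρ'⌋₊ :=
  Finset.Icc_subset_Icc_right (Nat.floor_le_floor (Real.rpow_le_rpow_of_exponent_le hx h))

/-- **The `(q, r)`-sum of one dyadic pair against the dilated ranges**: for `g ≥ 0`, `x ≥ 1`, `ρ ≤ ρ'`, `P ≥ 1`, `R ≥ 0`,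
`∑_{q ≤ x^ρ} ∑_{r ≤ R} g(q, rP) ≤ ∑_{q ≤ x^{ρ'}} ∑_{r' ≤ RP} g(q, r')`. [this line] -/
theorem sum_sum_le_dilate {g : ℕ → ℕ → ℝ} (hg : ∀ q r, 0 ≤ g q r) {x ρ ρ' : ℝ} (hx : 1 ≤ x) (hρ : ρ ≤ ρ')
    {P : ℕ} (hP : 1 ≤ P) {R : ℝ} (hR : 0 ≤ R) :
    ∑ q ∈ Icc 1 ⌊x ^ ρ⌋₊, ∑ r ∈ Icc 1 ⌊R⌋₊, g q (r * P) ≤ ∑ q ∈ Icc 1 ⌊x ^ ρ'⌋₊, ∑ r' ∈ Icc 1 ⌊R * P⌋₊, g q r' :=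
  calc ∑ q ∈ Icc 1 ⌊x ^ ρ⌋₊, ∑ r ∈ Icc 1 ⌊R⌋₊, g q (r * P)
      ≤ ∑ q ∈ Icc 1 ⌊x ^ ρ⌋₊, ∑ r' ∈ Icc 1 ⌊R * P⌋₊, g q r' :=
        Finset.sum_le_sum fun q _ => sum_le_sum_dilate (hg q) hP hR
    _ ≤ _ := Finset.sum_le_sum_of_subset_of_nonneg (Icc_floor_rpow_subset hx hρ)
        fun _ _ _ => Finset.sum_nonneg fun _ _ => hg _ _

/-- Landing anchor of the `𝔲_R`-bound chain, file 4; registered stub `urbChain4_anchor` of the crux item (the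
mathematical content of this file is `normSum_conv_le`). -/
theorem urbChain4_anchor : True := trivial

end Summit.Parity.GeneralizedHardyLittlewood.Cruxes.TypeI2Dilated.PeelToDrappeau

end
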